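import Literature.AnabelianGeometry.SemiGraphs.TemperedPiLevelKernelVertGen
import Literature.AnabelianGeometry.SemiGraphs.TemperedPiDeckCompact
import Literature.AnabelianGeometry.SemiGraphs.TemperedPiVirtuallyFreeTower
import HarnessLib

/-!
# The André tower of `π₁^temp(𝒢)` is CHARACTERISTIC at characteristic finite levels
# ([SemiAnbd] Prop. 3.6 p. 38, Thm. 3.7 (iii) p. 41; [André 2003] §4.5) — generic core

Mochizuki, *Semi-graphs of anabelioids*, Publ. RIMS **42** (2006) [SemiAnbd], Prop. 3.6 p. 38
("`π₁^temp(𝒢) := lim_i Gal(𝒢_{∞,i}/𝒢)`", with `𝒢_{∞,i}` "the covering … DETERMINED by the universal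
graph-covering of the underlying semi-graph `𝔾_i` of `𝒢_i`"), proof of Thm. 3.7 (iii) p. 41 ("a compact
subgroup … acts … through a finite quotient … fixes at least one vertex of `𝒢_{∞,i}`"), Ex. 3.10 p. 44
l. 9 ("open characteristic … subgroups"). [cite: MochizukiSemiAnbd2006, Prop 3.6 p.38]

PROOF-ONLY file (abc-iut cell, prover abc-iut-w5-d240; no definitions, no instances, no named facts),
first half of GAP-LEDGER row G-w5d240-1 (the MODEL residual B1′ of the Ex. 3.10 bridge
`TemperedCurve.tower_of_specialFibreTower`).  For Galois level data `D` of `𝒢` with connected levels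
(`hconn`), compatible point sequences `T` and reference branches `R` (the data of abc-iut-L3-d4's
presentation `D.piPresentation T R`), write `π_n : π₁^temp → Aut(S n)` for the finite levels
(`piLevelAut`) and `ρ_n : π₁^temp → Gal(𝒢_{∞,n}/𝒢)` for the tree levels (`projAut`).  Then:

* `compact_le_ker_projAut_of_le_ker_piLevelAut` — a COMPACT subgroup of `Ker π_n` lies in `Ker ρ_n`
  (it fixes a vertex of the tree `𝔾̃_n`, abc-iut-L3-t6's `exists_fixed_vertex_of_isCompact_over`, and a
  deck transformation fixing a vertex is trivial, `gal_eq_one_of_descendBaseAut_eq_one_of_fixes`);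
* `apply_mem_ker_projAut_of_forall_mem_ker_piLevelAut` — **every topological-group automorphism `α` of
  `π₁^temp(𝒢)` with `α(Ker π_n) ⊆ Ker π_n` satisfies `α(Ker ρ_n) ⊆ Ker ρ_n`**: by abc-iut-L3-d4's and abc-iut-L3-t9's
  `vertGen_ker_piLevelAut_eq` (`Ker ρ_n` is the closure of the subgroup generated by the compact pieces
  `Ker π_n ∩ g H_w g⁻¹`, Bass–Serre), and `α` carries each piece to a compact subgroup of `Ker π_n`;
  `map_ker_projAut_eq_of_map_ker_piLevelAut_eq` — hence `α(Ker π_n) = Ker π_n ⇒ α(Ker ρ_n) = Ker ρ_n`: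
  **at a CHARACTERISTIC finite level the André kernel is characteristic**;
* `exists_free_quotient_ker_projAut` — the quotient `π₁^temp/Ker ρ_n ≅ Gal(𝒢_{∞,n}/𝒢)` contains a
  free, normal, finite-index, finite-rank subgroup, non-abelian when the deck group `π₁(𝔾_n)` is
  (abc-iut-w5-d139's free-by-finite transport, with the explicit `N = Ker ρ_n`).

The sequel (`TemperedPiCharacteristicTowerOfCharCores.lean`) applies this at the characteristic Galois
tower `GaloisLevelData.ofCharCores`, whose finite levels ARE characteristic open cores
(abc-iut-L3-t9, `ArithTowerCharacteristicLevels.lean`).  Classical material; nothing here bears on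
[IUTchIII] Cor. 3.12 or takes a side on any disputed claim.
-/

noncomputable section

namespace Literature.AnabelianGeometry.SemiGraphs

namespace ProfiniteSemiGraph

namespace GaloisLevelData

open CategoryTheory Topology
open scoped Pointwise

universe u

variable {𝒢 : ProfiniteSemiGraph.{u}} (D : GaloisLevelData 𝒢) (h𝒢 : 𝒢.IsCountable)
  (hconn : ∀ (n : ℕ) (p q : (D.S n).Point), (D.S n).SameComponent p q)
  (T : ∀ w : 𝒢.graph.Vertex, D.PointSeq h𝒢 w) (R : SemiGraph.RefBranches 𝒢.graph)

/-! ### 1. Compact subgroups of a finite level lie in the tree level -/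

/-- **A compact subgroup of `Ker π_n` lies in `Ker ρ_n`** ([SemiAnbd] p. 41: a compact subgroup acts
on `𝒢_{∞,n}` through a finite quotient, hence fixes a vertex of the tree `𝔾̃_n`; an element of
`Ker π_n` acts on `𝒢_{∞,n}` by a deck transformation, and a deck transformation fixing a vertex is
trivial). [cite: MochizukiSemiAnbd2006, Thm 3.7(iii) p.41] -/
theorem compact_le_ker_projAut_of_le_ker_piLevelAut (n : ℕ) (C : Subgroup (D.temperedPi h𝒢))
    (hC : IsCompact (C : Set (D.temperedPi h𝒢))) (hle : C ≤ (D.piLevelAut h𝒢 hconn n).ker) :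
    C ≤ (D.projAut h𝒢 n).ker := by
  -- a vertex of `𝔾̃_n` fixed by all of `C`
  obtain ⟨x, hx⟩ := SemiGraph.exists_fixed_vertex_of_isCompact_over C hC (D.isTree_tree n)
    (D.treeVertex n) (D.treeProj n) (D.treeAct h𝒢 n) (D.isOpen_ker_treeAct h𝒢 n) (D.treeAct_over h𝒢 n)
  intro g hg
  have hπ : (D.S n).descendBaseAut h𝒢 (D.W n) (D.htrans n) (hconn n) (D.proj h𝒢 n g) = 1 := by
    have h := hle hg
    rw [MonoidHom.mem_ker, D.piLevelAut_apply h𝒢 hconn, D.descAut_apply] at h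
    exact h
  rw [MonoidHom.mem_ker]
  exact D.gal_eq_one_of_descendBaseAut_eq_one_of_fixes h𝒢 hconn n (D.proj h𝒢 n g) hπ x
    (by simpa only [treeAct_apply] using hx ⟨g, hg⟩)

/-! ### 2. Automorphisms stabilising a finite level stabilise its tree level -/

/-- The vertex groups `H_w` of the presentation are compact (images of the compact `Π_w`).
[cite: MochizukiSemiAnbd2006, Thm 3.7(i) p.40] -/
private theorem isCompact_H (w : 𝒢.graph.Vertex) :
    IsCompact (((D.piPresentation h𝒢 T R).H w : Subgroup (D.temperedPi h𝒢)) : Set (D.temperedPi h𝒢)) := by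
  change IsCompact (((T w).decompHom.range : Subgroup (D.temperedPi h𝒢)) : Set (D.temperedPi h𝒢))
  rw [MonoidHom.coe_range]
  exact isCompact_range (T w).continuous_decompHom

/-- The pieces `N ∩ g H_w g⁻¹` of `vertSup N` are compact for a closed level `N`.
[cite: MochizukiSemiAnbd2006, Thm 3.7(iii) p.41] -/
private theorem isCompact_piece (N : Subgroup (D.temperedPi h𝒢)) (hN : IsClosed (N : Set (D.temperedPi h𝒢)))
    (w : 𝒢.graph.Vertex) (g : D.temperedPi h𝒢) :
    IsCompact ((N ⊓ ((D.piPresentation h𝒢 T R).H w).map (MulAut.conj g).toMonoidHom :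
      Subgroup (D.temperedPi h𝒢)) : Set (D.temperedPi h𝒢)) := by
  have hc : Continuous (fun x : D.temperedPi h𝒢 => g * x * g⁻¹) :=
    (continuous_const.mul continuous_id).mul continuous_const
  have hK : IsCompact ((((D.piPresentation h𝒢 T R).H w).map (MulAut.conj g).toMonoidHom :
      Subgroup (D.temperedPi h𝒢)) : Set (D.temperedPi h𝒢)) := by
    rw [Subgroup.coe_map]
    have : ((MulAut.conj g).toMonoidHom : D.temperedPi h𝒢 → D.temperedPi h𝒢) =
        fun x => g * x * g⁻¹ := by
      funext x; rfl
    rw [this]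
    exact (D.isCompact_H h𝒢 T R w).image hc
  rw [Subgroup.coe_inf]
  exact hK.inter_left hN

include T R in
/-- **A topological-group automorphism stabilising the finite level `Ker π_n` stabilises the tree
level `Ker ρ_n`.**  `Ker ρ_n` is the closure of `vertSup (Ker π_n) = ⨆ (Ker π_n ∩ g H_w g⁻¹)`
(`vertGen_ker_piLevelAut_eq`, Bass–Serre); `α` carries each piece to a COMPACT subgroup of `Ker π_n`,
which lies in `Ker ρ_n` (`compact_le_ker_projAut_of_le_ker_piLevelAut`); and `Ker ρ_n` is closed.
[cite: MochizukiSemiAnbd2006, Prop 3.6 p.38] -/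
theorem apply_mem_ker_projAut_of_forall_mem_ker_piLevelAut
    (α : D.temperedPi h𝒢 ≃ₜ* D.temperedPi h𝒢) (n : ℕ)
    (hα : ∀ x ∈ (D.piLevelAut h𝒢 hconn n).ker, α x ∈ (D.piLevelAut h𝒢 hconn n).ker)
    {x : D.temperedPi h𝒢} (hx : x ∈ (D.projAut h𝒢 n).ker) : α x ∈ (D.projAut h𝒢 n).ker := by
  classical
  let P := D.piPresentation h𝒢 T R
  let N : Subgroup (D.temperedPi h𝒢) := (D.piLevelAut h𝒢 hconn n).ker
  let K : Subgroup (D.temperedPi h𝒢) := (D.projAut h𝒢 n).ker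
  have hNclosed : IsClosed (N : Set (D.temperedPi h𝒢)) :=
    Subgroup.isClosed_of_isOpen _ (D.isOpen_ker_piLevelAut h𝒢 hconn n)
  have hKclosed : IsClosed (K : Set (D.temperedPi h𝒢)) :=
    Subgroup.isClosed_of_isOpen _ (D.isOpen_ker_projAut h𝒢 n)
  -- Step 1: `α(vertSup N) ≤ K`
  have h1 : (P.vertSup N).map α.toMulEquiv.toMonoidHom ≤ K := by
    rw [SemiGraph.SubgroupPresentation.vertSup, Subgroup.map_iSup]
    refine iSup_le fun p => ?_
    refine D.compact_le_ker_projAut_of_le_ker_piLevelAut h𝒢 hconn n _ ?_ ?_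
    · rw [Subgroup.coe_map]
      exact (D.isCompact_piece h𝒢 T R N hNclosed p.1 p.2).image α.continuous
    · rintro _ ⟨y, hy, rfl⟩
      exact hα y hy.1
  -- Step 2: `x ∈ K = closure (vertSup N)`, so `α x ∈ closure (α (vertSup N)) ⊆ K`
  have hxK : x ∈ ((P.vertGen N : Subgroup (D.temperedPi h𝒢)) : Set (D.temperedPi h𝒢)) := by
    rw [D.vertGen_ker_piLevelAut_eq h𝒢 hconn T R n]
    exact hx
  rw [SemiGraph.SubgroupPresentation.vertGen, Subgroup.topologicalClosure_coe] at hxK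
  have himg : α x ∈ closure (α '' ((P.vertSup N : Subgroup (D.temperedPi h𝒢)) : Set (D.temperedPi h𝒢))) :=
    image_closure_subset_closure_image α.continuous ⟨x, hxK, rfl⟩
  have hsub : α '' ((P.vertSup N : Subgroup (D.temperedPi h𝒢)) : Set (D.temperedPi h𝒢)) ⊆ K := by
    rintro _ ⟨y, hy, rfl⟩
    exact h1 ⟨y, hy, rfl⟩
  exact closure_minimal hsub hKclosed himg

include T R in
/-- **At a characteristic finite level the André kernel is characteristic**: if the topological-group
automorphism `α` satisfies `α(Ker π_n) = Ker π_n`, then `α(Ker ρ_n) = Ker ρ_n`.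
[cite: MochizukiSemiAnbd2006, Prop 3.6 p.38] -/
theorem map_ker_projAut_eq_of_map_ker_piLevelAut_eq (α : D.temperedPi h𝒢 ≃ₜ* D.temperedPi h𝒢) (n : ℕ)
    (hα : ((D.piLevelAut h𝒢 hconn n).ker).map α.toMulEquiv.toMonoidHom = (D.piLevelAut h𝒢 hconn n).ker) :
    ((D.projAut h𝒢 n).ker).map α.toMulEquiv.toMonoidHom = (D.projAut h𝒢 n).ker := by
  -- the finite level is stable under `α` and under `α⁻¹`
  have hfwd : ∀ x ∈ (D.piLevelAut h𝒢 hconn n).ker, α x ∈ (D.piLevelAut h𝒢 hconn n).ker :=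
    fun x hx => hα.le ⟨x, hx, rfl⟩
  have hbwd : ∀ x ∈ (D.piLevelAut h𝒢 hconn n).ker, α.symm x ∈ (D.piLevelAut h𝒢 hconn n).ker := by
    intro x hx
    have hx' : x ∈ ((D.piLevelAut h𝒢 hconn n).ker).map α.toMulEquiv.toMonoidHom := by rw [hα]; exact hx
    obtain ⟨y, hy, rfl⟩ := hx'
    change α.symm (α y) ∈ _
    rw [ContinuousMulEquiv.symm_apply_apply]
    exact hy
  refine le_antisymm ?_ ?_
  · rintro _ ⟨x, hx, rfl⟩
    exact D.apply_mem_ker_projAut_of_forall_mem_ker_piLevelAut h𝒢 hconn T R α n hfwd hx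
  · intro x hx
    refine ⟨α.symm x, ?_, by change α (α.symm x) = x; exact α.apply_symm_apply x⟩
    exact D.apply_mem_ker_projAut_of_forall_mem_ker_piLevelAut h𝒢 hconn T R α.symm n hbwd hx

/-! ### 3. The quotient by a tree level is virtually free (with the explicit `N = Ker ρ_n`) -/

/-- **`π₁^temp(𝒢)/Ker ρ_n ≅ Gal(𝒢_{∞,n}/𝒢)` contains a free, normal, finite-index, finite-rank,
non-abelian subgroup** as soon as the level `S n` has fibre-rigid endomorphisms, finite base fibre, and
free deck group `π₁(𝔾_n, [x_n])` of finite rank which is non-abelian (the deck exact sequence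
`1 → π₁(𝔾_n) → Gal(𝒢_{∞,n}/𝒢) → Aut(S n)`; abc-iut-w5-d139's free-by-finite transport — here with the
open normal subgroup `Ker ρ_n` made explicit). [cite: MochizukiSemiAnbd2006, Prop 3.6 p.38] -/
theorem exists_free_quotient_ker_projAut (n : ℕ)
    (hrigid : ∀ (σ σ' : D.S n ⟶ D.S n),
      (σ.fV D.v₀).hom.hom (D.x n) = (σ'.fV D.v₀).hom.hom (D.x n) → σ = σ')
    (hfin : Finite (((D.S n).SV D.v₀).obj.V))
    (hrank : ∃ _ : IsFreeGroup ((D.S n).orbitGraph.FundamentalGroup ((D.S n).baseComp D.v₀ (D.x n))),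
      Finite (IsFreeGroup.Generators ((D.S n).orbitGraph.FundamentalGroup ((D.S n).baseComp D.v₀ (D.x n)))))
    (hab : ∃ a b : (D.S n).orbitGraph.FundamentalGroup ((D.S n).baseComp D.v₀ (D.x n)), a * b ≠ b * a) :
    ∃ (G : Subgroup (D.temperedPi h𝒢 ⧸ (D.projAut h𝒢 n).ker)) (_ : IsFreeGroup G), G.Normal ∧
      G.FiniteIndex ∧ Finite (IsFreeGroup.Generators G) ∧ ∃ a ∈ G, ∃ b ∈ G, a * b ≠ b * a := by
  let F : CovObj 𝒢 := D.S n
  have htrans : ∀ x : (F.SV D.v₀).obj.V, ∃ σ : F ⟶ F, (σ.fV D.v₀).hom.hom (D.x n) = x :=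
    fun x => D.htrans n D.v₀ (D.x n) x
  haveI : Finite ((F.SV D.v₀).obj.V) := hfin
  haveI : Finite (Aut F) := CovObj.finite_aut_of_rigid F D.v₀ (D.x n) hrigid
  let e : D.temperedPi h𝒢 ⧸ (D.projAut h𝒢 n).ker ≃* D.Gal h𝒢 n :=
    QuotientGroup.quotientKerEquivOfSurjective (D.proj h𝒢 n) (D.proj_surjective h𝒢 n)
  exact exists_free_normal_finiteIndex_of_free_by_finite
    (CovObj.deckHom F D.v₀ (D.x n) h𝒢)
    (CovObj.autDescendHom F D.v₀ (D.x n) h𝒢 htrans hrigid)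
    (CovObj.deckHom_injective F D.v₀ (D.x n) h𝒢)
    (CovObj.range_deckHom_eq_ker F D.v₀ (D.x n) h𝒢 htrans hrigid)
    hrank hab e

end GaloisLevelData

end ProfiniteSemiGraph

end Literature.AnabelianGeometry.SemiGraphs

end
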